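import Mathlib
import Literature.Analysis.FluidPDE.Tao2016AveragedNS.BoundedEternalSolutions
import Summits.NavierStokesRegularity.NavierStokesRegularity.Theses.TaoLadderRungTwoBreak
import Summits.NavierStokesRegularity.NavierStokesRegularity.Theorems.TaoLadderRungTwoBreakNoSurvivingEternalViscBddOneUpwardFluxVisc
import HarnessLib

/-!
# The UPWARD-FLUX (no-backscatter) RUNG of K1ᵛ(1) `TaoLadderRungTwoBreak.NoSurvivingEternalViscBddOne`
# (stmt-NavierStokesRegularity-20419): a LOGARITHMIC action floor off the self-similar stratum, for every `ν̂ ≥ 0`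

MODEL lattice ODEs only (Tao 2016 §4, §6.4; cell vocabulary `IsEternalVisc`, `UniformBound`, `physEnergy`, `physFlux`,
`EternalSurvivingFwd`, `NoSurvivingEternalViscBdd`); nothing here is a statement about the Navier–Stokes equations; no summit, crux
or rung LEAF is proved (`--supports stmt-NavierStokesRegularity-20419`).  Sequel to `…UpwardFluxThroughput` / `…UpwardFluxVisc`
(throughput recursion `Φ_{k+1} ≤ (1 − e^{−κ}/(1+κ))Φ_k` for uniformly bounded admissible eternal solutions — ANY covariant viscosity
`ν̂ ≥ 0` — of a cancelling table whose bond fluxes are all non-negative, `κ = 2C_AΛ⁻¹·(action of the shell above)`).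

* `not_survivingFwd_of_upwardFlux` — with a uniform action budget `∫‖W_n‖ ≤ M`, `ρ = 1 − e^{−κ}/(1+κ)`, `κ = 2C_AΛ⁻¹M` and
  `(1+ε₀)ρ < 1`, the solution is NOT forward (S₁)-surviving (`(1+ε₀)ⁿE_n ≤ ((1+ε₀)ρ)ⁿΦ_{−1} → 0`);
* `not_survivingFwd_of_upwardFlux_logAction` — on a table of `InTableClass R`, `0 < ε₀ < 1`, the budget `M ≤ log(1/ε₀)/512` suffices
  (`e^{−κ}/(1+κ) ≥ e^{−2κ} ≥ √ε₀ > ε₀`): **a surviving sign-coherent uniformly bounded admissible eternal solution (any `ν̂ ≥ 0`) pays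
  action `> log(1/ε₀)/512` on some shell** (`exists_action_gt_log_of_survivingFwd`) — the logarithmic action floor, previously
  known only on the DSS stratum (`…NoSurvivingDSSOneActionFloor`, `He^{H} ≳ 1/ε₀`), holds off it as soon as there is no backscatter;
* `noSurvivingEternalViscBdd_rung_upwardFlux` — **the slice in the binder shape of the crux's own predicate
  `NoSurvivingEternalViscBdd R 1`** (threshold `1/2`, two extra hypotheses: sign-coherent fluxes and the GROWING budget
  `log(1/ε₀)/512` — the tree's small-action rungs had the fixed budgets `1/400`, `1/300`); its inviscid and loud-ladder readings
  `noSurvivingEternalBdd_rung_upwardFlux` (ρ0) / `noLoudLadder_rung_upwardFlux` (ρ+); and `upwardFlux_of_noSurvivingEternalViscBddOne`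
  (a case of the crux ⟨20419⟩ by name).

READING for the census of ⟨20419⟩: in the no-backscatter class the K1ᵛ wall is `{sup_n ∫‖W_n‖ ≳ log(1/ε₀)}`; BACKSCATTER (sign
changes of the bond pairing `⟪W_{k+1}, A W_k⟫`: energy handed back down the ladder and re-sent) is the only mechanism by which a
front of bounded action could survive at small `ε₀` — the next lemma to want is a control of `∫(F_k)⁻` by the throughput `Φ_k`.
HONEST LABEL: a rung; (ρ0), (ρ+), ⟨20419⟩ and every NS statement remain OPEN.
-/

noncomputable section

-- the summit and its single sub-problem share the name (CONVENTIONS §1)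
set_option linter.dupNamespace false

namespace Summit.NavierStokesRegularity.NavierStokesRegularity.Theorems.NoSurvivingEternalViscBddOne.UpwardFlux

open Set Filter Topology MeasureTheory
open scoped RealInnerProductSpace
open Literature.Analysis.FluidPDE Literature.Analysis.FluidPDE.TaoCascade
open Summit.NavierStokesRegularity.NavierStokesRegularity.Theses.TaoLadderRungTwoBreak
open Summit.NavierStokesRegularity.NavierStokesRegularity.Theorems.NoSurvivingEternalViscBddOne.SmallAction (fluxConst_le_64)

variable {m : ℕ} {ε₀ νh : ℝ} {α : Fin m → Fin m → Fin m → ℤ × ℤ × ℤ → ℝ} {W : ℤ → ℝ → Em m}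

/-! ## No survival in the sign-coherent class under the wake budget -/

/-- **NO SURVIVAL WITHOUT BACKSCATTER BELOW THE WAKE BUDGET** (any `ν̂ ≥ 0`).  A uniformly bounded admissible eternal solution of a
cancelling table at `ε₀ > 0` whose bond fluxes are all non-negative and whose per-shell actions satisfy `∫‖W_n‖ ≤ M` with
`(1+ε₀)·(1 − e^{−κ}/(1+κ)) < 1`, `κ = 2C_AΛ⁻¹M` (each shell keeps or dissipates more than the fraction `ε₀/(1+ε₀)` of what reaches it),
is NOT forward (S₁)-surviving: `(1+ε₀)ⁿE_n ≤ ((1+ε₀)ρ)ⁿ·Φ_{−1} → 0`.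
[cite: Tao2016AveragedNS, §4 Lemma 4.1 (4.8)–(4.10) with (4.3) and the viscous equation before Thm. 4.2, §6.4; this file] -/
theorem not_survivingFwd_of_upwardFlux (hε : 0 < ε₀) (hW : IsEternalVisc ε₀ νh α W) (hc : IsCancellingCoeff α)
    (hU : UniformBound W) (hF : ∀ (j : ℤ) (s : ℝ), 0 ≤ physFlux ε₀ α W j s) {M : ℝ} (hM : ∀ n, ∫ s, ‖W n s‖ ≤ M)
    (hsmall : (1 + ε₀) * (1 - Real.exp (-(2 * fluxConst α * (bigLam ε₀)⁻¹ * M))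
      / (1 + 2 * fluxConst α * (bigLam ε₀)⁻¹ * M)) < 1) :
    ¬ EternalSurvivingFwd 1 ε₀ W := by
  set ρ := 1 - Real.exp (-(2 * fluxConst α * (bigLam ε₀)⁻¹ * M)) / (1 + 2 * fluxConst α * (bigLam ε₀)⁻¹ * M)
    with hρ
  have hM0 : 0 ≤ M := le_trans (integral_nonneg fun s => norm_nonneg (W 0 s)) (hM 0)
  have hκnn : 0 ≤ 2 * fluxConst α * (bigLam ε₀)⁻¹ * M := by
    have := fluxConst_nonneg α; have := (bigLam_pos (by linarith : (-1 : ℝ) < ε₀)).le; positivity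
  have hρ0 : 0 ≤ ρ := (ratio_bounds hκnn).1
  have hq0 : 0 ≤ (1 + ε₀) * ρ := by positivity
  have hq1 : (1 + ε₀) * ρ < 1 := hsmall
  -- the throughput of the bond `-1 → 0` controls everything above
  set A₀ := ∫ s, physFlux ε₀ α W (-1) s with hA₀
  have hA₀nn : 0 ≤ A₀ := integral_nonneg fun s => hF (-1) s
  have hpow := throughput_le_pow_visc hε hW hc hU hF hM (-1)
  have hEn : ∀ (n : ℕ) (σ : ℝ), physEnergy ε₀ W n σ ≤ ρ ^ n * A₀ := by
    intro n σ
    have h1 : physEnergy ε₀ W ((-1 + n) + 1) σ ≤ ∫ s, physFlux ε₀ α W (-1 + n) s :=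
      physEnergy_le_throughput_visc hε hW hc hU hF (-1 + n) σ
    rw [show (-1 + (n : ℤ)) + 1 = n by ring] at h1
    exact h1.trans (hpow n)
  rintro ⟨c, hc0, hcN⟩
  obtain ⟨N, hN⟩ : ∃ N : ℕ, ((1 + ε₀) * ρ) ^ N * A₀ < c := by
    have ht : Tendsto (fun n : ℕ => ((1 + ε₀) * ρ) ^ n * A₀) atTop (𝓝 (0 * A₀)) :=
      (tendsto_pow_atTop_nhds_zero_of_lt_one hq0 hq1).mul_const A₀
    rw [zero_mul] at ht
    exact (ht.eventually (gt_mem_nhds hc0)).exists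
  obtain ⟨n, hnN, σ, -, hcle⟩ := hcN N
  have hw : physWeight 1 ε₀ ^ n * (Real.exp (2 * σ) * ‖W n σ‖ ^ 2) = (1 + ε₀) ^ n * physEnergy ε₀ W n σ := by
    have := wtEnergy_eq hε W n σ; unfold wtEnergy at this; exact this
  rw [hw] at hcle
  have hb : (1 + ε₀) ^ n * physEnergy ε₀ W n σ ≤ ((1 + ε₀) * ρ) ^ n * A₀ := by
    calc (1 + ε₀) ^ n * physEnergy ε₀ W n σ ≤ (1 + ε₀) ^ n * (ρ ^ n * A₀) :=
          mul_le_mul_of_nonneg_left (hEn n σ) (by positivity)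
      _ = ((1 + ε₀) * ρ) ^ n * A₀ := by rw [mul_pow]; ring
  have hmono : ((1 + ε₀) * ρ) ^ n * A₀ ≤ ((1 + ε₀) * ρ) ^ N * A₀ :=
    mul_le_mul_of_nonneg_right (pow_le_pow_of_le_one hq0 hq1.le hnN) hA₀nn
  linarith

/-- **The logarithmic budget.**  For `0 < ε₀ < 1`, `0 ≤ κ ≤ log(1/ε₀)/4`:  `(1+ε₀)(1 − e^{−κ}/(1+κ)) < 1`
(`e^{−κ}/(1+κ) ≥ e^{−2κ} ≥ √ε₀ > ε₀ ≥ ε₀/(1+ε₀)`).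
[folklore] -/
theorem ratio_lt_of_le_log {ε₀ κ : ℝ} (hε : 0 < ε₀) (hε1 : ε₀ < 1) (hκ : 0 ≤ κ)
    (hκL : κ ≤ Real.log (1 / ε₀) / 4) : (1 + ε₀) * (1 - Real.exp (-κ) / (1 + κ)) < 1 := by
  have h1κ : 0 < 1 + κ := by linarith
  have hl0 : 0 < 1 + ε₀ := by linarith
  -- `t = e^{log ε₀ /2}` with `t² = ε₀`, `ε₀ < t < 1`
  set t := Real.exp (Real.log ε₀ / 2) with ht
  have ht0 : 0 < t := Real.exp_pos _
  have ht2 : t ^ 2 = ε₀ := by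
    rw [ht, ← Real.exp_nat_mul]
    rw [show ((2 : ℕ) : ℝ) * (Real.log ε₀ / 2) = Real.log ε₀ by push_cast; ring]
    exact Real.exp_log hε
  have ht1 : t < 1 := by
    by_contra h
    push Not at h
    have : 1 ≤ t ^ 2 := by nlinarith
    linarith
  have htε : ε₀ < t := by nlinarith
  -- `e^{-2κ} ≥ t`
  have hlog : Real.log (1 / ε₀) = -Real.log ε₀ := by rw [one_div, Real.log_inv]
  have h2κ : Real.log ε₀ / 2 ≤ -(2 * κ) := by rw [hlog] at hκL; linarith
  have hexp2 : t ≤ Real.exp (-(2 * κ)) := Real.exp_le_exp.2 h2κ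
  -- `e^{-κ}/(1+κ) ≥ e^{-2κ}`
  have hquot : Real.exp (-(2 * κ)) ≤ Real.exp (-κ) / (1 + κ) := by
    rw [le_div_iff₀ h1κ]
    have h1 : 1 + κ ≤ Real.exp κ := by have := Real.add_one_le_exp κ; linarith
    have h2 : Real.exp (-(2 * κ)) * Real.exp κ = Real.exp (-κ) := by rw [← Real.exp_add]; congr 1; ring
    calc Real.exp (-(2 * κ)) * (1 + κ) ≤ Real.exp (-(2 * κ)) * Real.exp κ :=
          mul_le_mul_of_nonneg_left h1 (Real.exp_pos _).le
      _ = Real.exp (-κ) := h2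
  have hq : ε₀ < Real.exp (-κ) / (1 + κ) := by linarith
  nlinarith [div_pos (Real.exp_pos (-κ)) h1κ]

/-- **THE LOGARITHMIC ACTION FLOOR OFF THE SELF-SIMILAR STRATUM (no-backscatter class, any `ν̂ ≥ 0`).**  On a table of
`InTableClass R` (`C_A ≤ 64`, `Λ ≥ 1`), for `0 < ε₀ < 1`: a uniformly bounded admissible eternal solution with covariant viscosity,
non-negative bond fluxes and per-shell actions `∫‖W_n‖ ≤ log(1/ε₀)/512` is NOT forward (S₁)-surviving.
[cite: Tao2016AveragedNS, §4 Thm. 4.2 (statement shape), Lemma 4.1 (4.8)–(4.10), §6.4; this file] -/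
theorem not_survivingFwd_of_upwardFlux_logAction {R : ℝ} (hε : 0 < ε₀) (hε1 : ε₀ < 1)
    {α : Fin 4 → Fin 4 → Fin 4 → ℤ × ℤ × ℤ → ℝ} (hα : InTableClass R α) {νh : ℝ} {W : ℤ → ℝ → Em 4}
    (hW : IsEternalVisc ε₀ νh α W) (hU : UniformBound W) (hF : ∀ (j : ℤ) (s : ℝ), 0 ≤ physFlux ε₀ α W j s)
    (hM : ∀ n, ∫ s, ‖W n s‖ ≤ Real.log (1 / ε₀) / 512) : ¬ EternalSurvivingFwd 1 ε₀ W := by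
  set M := Real.log (1 / ε₀) / 512 with hMdef
  have hC := fluxConst_le_64 hα
  have hC0 := fluxConst_nonneg α
  have hΛ1 : (bigLam ε₀)⁻¹ ≤ 1 := inv_le_one_of_one_le₀ (one_le_bigLam hε.le)
  have hΛ0 : 0 ≤ (bigLam ε₀)⁻¹ := inv_nonneg.2 (bigLam_pos (by linarith)).le
  have hL0 : 0 ≤ Real.log (1 / ε₀) := Real.log_nonneg (by rw [le_div_iff₀ hε]; linarith)
  have hM0 : 0 ≤ M := by positivity
  have hk : 2 * fluxConst α * (bigLam ε₀)⁻¹ ≤ 128 := by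
    have := mul_le_mul (mul_le_mul_of_nonneg_left hC (by norm_num : (0 : ℝ) ≤ 2)) hΛ1 hΛ0 (by positivity)
    linarith
  have hκnn : 0 ≤ 2 * fluxConst α * (bigLam ε₀)⁻¹ * M := by positivity
  have hκL : 2 * fluxConst α * (bigLam ε₀)⁻¹ * M ≤ Real.log (1 / ε₀) / 4 := by
    calc 2 * fluxConst α * (bigLam ε₀)⁻¹ * M ≤ 128 * M := mul_le_mul_of_nonneg_right hk hM0
      _ = Real.log (1 / ε₀) / 4 := by rw [hMdef]; ring
  exact not_survivingFwd_of_upwardFlux hε hW hα.2.1 hU hF hM (ratio_lt_of_le_log hε hε1 hκnn hκL)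

/-- **Contrapositive reading: survival forces an expensive shell.**  A SURVIVING uniformly bounded admissible eternal solution (any
`ν̂ ≥ 0`) with non-negative bond fluxes on a table of `InTableClass R`, `0 < ε₀ < 1`, pays action `> log(1/ε₀)/512` on some shell.
[cite: Tao2016AveragedNS, §4 Thm. 4.2 (statement shape), §6.4; this file] -/
theorem exists_action_gt_log_of_survivingFwd {R : ℝ} (hε : 0 < ε₀) (hε1 : ε₀ < 1)
    {α : Fin 4 → Fin 4 → Fin 4 → ℤ × ℤ × ℤ → ℝ} (hα : InTableClass R α) {νh : ℝ} {W : ℤ → ℝ → Em 4}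
    (hW : IsEternalVisc ε₀ νh α W) (hU : UniformBound W) (hF : ∀ (j : ℤ) (s : ℝ), 0 ≤ physFlux ε₀ α W j s)
    (hS : EternalSurvivingFwd 1 ε₀ W) : ∃ n : ℤ, Real.log (1 / ε₀) / 512 < ∫ s, ‖W n s‖ := by
  by_contra h
  push Not at h
  exact not_survivingFwd_of_upwardFlux_logAction hε hε1 hα hW hU hF h hS

/-! ## The slice of the crux's predicate, and its (ρ0) / (ρ+) readings -/

/-- **THE UPWARD-FLUX SLICE OF K1ᵛ(1) IS A THEOREM.**  For every spread `R`, with threshold `εs = 1/2`: for all `ε₀ ∈ (0, 1/2]`, no table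
of `InTableClass R` carries a uniformly bounded admissible eternal solution with covariant viscosity (any `ν̂ ≥ 0`), non-negative bond
fluxes and per-shell actions `≤ log(1/ε₀)/512` that is forward (S₁)-surviving — the quantifier shape of
`TaoCascade.NoSurvivingEternalViscBdd R 1` with two extra hypotheses.
[cite: Tao2016AveragedNS, §4 Thm. 4.2 (statement shape), Lemma 4.1 (4.8)–(4.10), §6.4; this file] -/
theorem noSurvivingEternalViscBdd_rung_upwardFlux (R : ℝ) :
    ∃ εs : ℝ, 0 < εs ∧ ∀ ε₀ : ℝ, 0 < ε₀ → ε₀ ≤ εs →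
      ∀ α : Fin 4 → Fin 4 → Fin 4 → ℤ × ℤ × ℤ → ℝ, InTableClass R α →
        ∀ (νh : ℝ) (W : ℤ → ℝ → Em 4), IsEternalVisc ε₀ νh α W → UniformBound W →
          (∀ (j : ℤ) (s : ℝ), 0 ≤ physFlux ε₀ α W j s) →
          (∀ n, ∫ s, ‖W n s‖ ≤ Real.log (1 / ε₀) / 512) → ¬ EternalSurvivingFwd 1 ε₀ W := by
  refine ⟨1 / 2, by norm_num, fun ε₀ hε hle α hα νh W hW hU hF hM => ?_⟩
  exact not_survivingFwd_of_upwardFlux_logAction hε (by linarith) hα hW hU hF hM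

/-- **(ρ0) reading** — the slice in the binder shape of `NoSurvivingEternalBdd R 1` (the registered stub `stub_noSurvivingEternalBddOne`
quantifies over `IsEternal`, the `ν̂ = 0` case).
[cite: Tao2016AveragedNS, §4 Thm. 4.2 (statement shape), §6.4; this file] -/
theorem noSurvivingEternalBdd_rung_upwardFlux (R : ℝ) :
    ∃ εs : ℝ, 0 < εs ∧ ∀ ε₀ : ℝ, 0 < ε₀ → ε₀ ≤ εs →
      ∀ α : Fin 4 → Fin 4 → Fin 4 → ℤ × ℤ × ℤ → ℝ, InTableClass R α →
        ∀ W : ℤ → ℝ → Em 4, IsEternal ε₀ α W → UniformBound W →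
          (∀ (j : ℤ) (s : ℝ), 0 ≤ physFlux ε₀ α W j s) →
          (∀ n, ∫ s, ‖W n s‖ ≤ Real.log (1 / ε₀) / 512) → ¬ EternalSurvivingFwd 1 ε₀ W := by
  refine ⟨1 / 2, by norm_num, fun ε₀ hε hle α hα W hW hU hF hM => ?_⟩
  exact not_survivingFwd_of_upwardFlux_logAction hε (by linarith) hα hW.isEternalVisc hU hF hM

/-- **(ρ+) reading** — the slice in the binder shape of `NoLoudLadder R` (the registered stub `stub_noLoudLadderOne`: `ν̂ > 0`, every shell
loud); loudness is not even needed in the sign-coherent class below the logarithmic budget.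
[cite: Tao2016AveragedNS, §4 Thm. 4.2 (statement shape), §6.4; this file] -/
theorem noLoudLadder_rung_upwardFlux (R : ℝ) :
    ∃ εs : ℝ, 0 < εs ∧ ∀ ε₀ : ℝ, 0 < ε₀ → ε₀ ≤ εs →
      ∀ α : Fin 4 → Fin 4 → Fin 4 → ℤ × ℤ × ℤ → ℝ, InTableClass R α →
        ∀ (νh : ℝ) (W : ℤ → ℝ → Em 4), 0 < νh → IsEternalVisc ε₀ νh α W → UniformBound W →
          (∀ n₀ : ℕ, ∀ s₀ : ℝ, s₀ < νh ^ 2 / 4096 → ∃ σ : ℝ, s₀ < wtEnergy ε₀ W n₀ σ) →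
          (∀ (j : ℤ) (s : ℝ), 0 ≤ physFlux ε₀ α W j s) →
          (∀ n, ∫ s, ‖W n s‖ ≤ Real.log (1 / ε₀) / 512) → ¬ EternalSurvivingFwd 1 ε₀ W := by
  refine ⟨1 / 2, by norm_num, fun ε₀ hε hle α hα νh W _ hW hU _ hF hM => ?_⟩
  exact not_survivingFwd_of_upwardFlux_logAction hε (by linarith) hα hW hU hF hM

/-- **A case of the crux ⟨20419⟩ by name**: `NoSurvivingEternalViscBddOne` (`∀ R ≥ 1, NoSurvivingEternalViscBdd R 1`) contains the
upward-flux slice (it forbids survival of EVERY uniformly bounded admissible eternal solution below its threshold).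
[cite: Tao2016AveragedNS, §4 Thm. 4.2 (statement shape), §6.4; this file] -/
theorem upwardFlux_of_noSurvivingEternalViscBddOne (h : NoSurvivingEternalViscBddOne) (R : ℝ) (hR : 1 ≤ R) :
    ∃ εs : ℝ, 0 < εs ∧ ∀ ε₀ : ℝ, 0 < ε₀ → ε₀ ≤ εs →
      ∀ α : Fin 4 → Fin 4 → Fin 4 → ℤ × ℤ × ℤ → ℝ, InTableClass R α →
        ∀ (νh : ℝ) (W : ℤ → ℝ → Em 4), IsEternalVisc ε₀ νh α W → UniformBound W →
          (∀ (j : ℤ) (s : ℝ), 0 ≤ physFlux ε₀ α W j s) →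
          (∀ n, ∫ s, ‖W n s‖ ≤ Real.log (1 / ε₀) / 512) → ¬ EternalSurvivingFwd 1 ε₀ W := by
  obtain ⟨εs, hεs, H⟩ := h R hR
  exact ⟨εs, hεs, fun ε₀ hε hle α hα νh W hW hU _ _ => H ε₀ hε hle α hα νh W hW hU⟩

end Summit.NavierStokesRegularity.NavierStokesRegularity.Theorems.NoSurvivingEternalViscBddOne.UpwardFlux

end
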